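import Mathlib
import HarnessLib
import Summits.NavierStokesRegularity.NavierStokesRegularity.Theorems.PoloidalWindowDoorLrcModEntireTwistingTHFlatSlicePressure

/-!
# Item `LrcModEntire` (stmt-NavierStokesRegularity-20428), skeleton twist_split v6 — **the hot-spot pins at an ARBITRARY hot point** (translation of the tree's
# thread pins): gradient, time, Laplacian and Hessian pins and the vertical pressure identity `∂_z P(−1,y) = Δv₂(−1,·)(y) − N/2` at every `y` with `v₂(−1,y) = N`

Cell ns-regularity-ideate, LEAD ns-poloidal-K2-p3 g13 (`--supports stmt-NavierStokesRegularity-20428`; CELLS-TH-g13 §1–§2bis).  The tree's pins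
(`…ThreadPins.threadPin_of_hotSpot` / `threadTimePin` / `threadSpacePin`, `…ThreadPressure.threadPressure_eq` / `threadHessianPin`) are stated at the normalised hot
spot `(−1, 0)`.  On a RIDGE (cell T2b) or a FLAT THREAD PLANE (cell T1) every point `y` of the hot set, `v₂(−1,y) = v₂(−1,0) =: N`, is itself a space–time hot spot of
the translated profile `(t, w) ↦ v(t, w + y)` — which is again in the class (`…TwistingTHFlatSlicePressure.class_comp_add_right`) with the same hot-spot bound.  Hence:

* `gradPin_of_hotPoint` — `∇v₂(−1,y) = 0`;  `timePin_of_hotPoint` — `∂ₜv₂(−1,y) = N/2`;  `laplacianPin_of_hotPoint` — `N·Δv₂(−1,·)(y) ≤ 0`;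
  `hessianPin_of_hotPoint` — `N·D²v₂(−1,·)(y)[w,w] ≤ 0`;
* `gradient_pressure_two_of_hotPoint` — for every classical pressure `P`: `(∇P(−1,·))(y)₂ = Δv₂(−1,·)(y) − N/2`, and `pressurePush_of_hotPoint`: `N·(∇P)₂(y) ≤ −N²/2`
  (the pressure pushes DOWN along the whole ridge / hot plane).

WHAT THIS IS NOT: not a claim about Navier–Stokes regularity; pure bookkeeping for the cells T1 / T2b / C2a′ / C2b′ (bears_on LADDER-NS N0, item 20428 / crux 19708; OPEN).
-/

noncomputable section

-- the summit and its single sub-problem share the name (CONVENTIONS §1), as in every Theorems file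
set_option linter.dupNamespace false

namespace Summit.NavierStokesRegularity.NavierStokesRegularity.Theorems.PoloidalWindowDoorLrcModEntireTwistingTHHotPointPins

open MeasureTheory Set Function Filter Topology
open scoped RealInnerProductSpace InnerProductSpace Laplacian ContDiff
open Literature.Analysis Literature.Analysis.FluidPDE Literature.Analysis.UnboundedOperators
open Summit.NavierStokesRegularity.NavierStokesRegularity.Theorems
open Summit.NavierStokesRegularity.NavierStokesRegularity.Theorems.PoloidalWindowDoorLrcModEntireThreadPins
open Summit.NavierStokesRegularity.NavierStokesRegularity.Theorems.PoloidalWindowDoorPoloidalWindowRigidityLocalFrozenLaw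
open Summit.NavierStokesRegularity.NavierStokesRegularity.Theorems.PoloidalWindowDoorPoloidalWindowRigidityWindow
open Summit.NavierStokesRegularity.NavierStokesRegularity.Theorems.PoloidalWindowDoorLrcModEntireThreadPressure
open Summit.NavierStokesRegularity.NavierStokesRegularity.Theorems.PoloidalWindowDoorLrcModEntireTwistingTHFlatSlicePressure

variable {C : ℝ} {v : ℝ → EuclideanSpace ℝ (Fin 3) → EuclideanSpace ℝ (Fin 3)}

/-- The translated profile `(t, w) ↦ v(t, w + y)` at a hot point `y` (`v₂(−1,y) = v₂(−1,0) ≠ 0`) satisfies the hot-spot normalisation at `0`. -/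
theorem hotNormalisation_translate (hne : v (-1) 0 2 ≠ 0) (hhot : ∀ t < 0, ∀ x, Real.sqrt (-t) * |v t x 2| ≤ |v (-1) 0 2|)
    {y : EuclideanSpace ℝ (Fin 3)} (hy : v (-1) y 2 = v (-1) 0 2) :
    (fun t w => v t (w + y)) (-1) 0 2 ≠ 0 ∧
      ∀ t < 0, ∀ x, Real.sqrt (-t) * |(fun t w => v t (w + y)) t x 2| ≤ |(fun t w => v t (w + y)) (-1) 0 2| := by
  have h0 : v (-1) (0 + y) 2 = v (-1) 0 2 := by rw [zero_add]; exact hy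
  refine ⟨?_, fun t ht x => ?_⟩
  · show v (-1) (0 + y) 2 ≠ 0
    rw [h0]; exact hne
  · show Real.sqrt (-t) * |v t (x + y) 2| ≤ |v (-1) (0 + y) 2|
    rw [h0]; exact hhot t ht (x + y)

/-- **Gradient pin at every hot point:** `∇v₂(−1,y) = 0` whenever `v₂(−1,y) = v₂(−1,0)` (no sign condition needed). -/
theorem gradPin_of_hotPoint (hrate : HasTypeITimeDecay C v)
    (hcont : ContinuousOn (uncurry v) (Iio (0 : ℝ) ×ˢ univ))
    (hmild : ∀ s t : ℝ, s < t → t < 0 → ∀ x, v t x = heatExtension (v s) (t - s) x - oseenDuhamel 1 s v v t x)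
    (hdiv : ∀ t < 0, VectorCalculus.IsDivFree (v t))
    (hhot : ∀ t < 0, ∀ x, Real.sqrt (-t) * |v t x 2| ≤ |v (-1) 0 2|)
    {y : EuclideanSpace ℝ (Fin 3)} (hy : v (-1) y 2 = v (-1) 0 2) (h : EuclideanSpace ℝ (Fin 3)) :
    fderiv ℝ (v (-1)) y h 2 = 0 := by
  obtain ⟨hrate', hcont', hmild', -⟩ := class_comp_add_right hrate hcont hmild hdiv y
  have h0 : v (-1) (0 + y) 2 = v (-1) 0 2 := by rw [zero_add]; exact hy
  have hhot' : ∀ t < 0, ∀ x, Real.sqrt (-t) * |(fun t w => v t (w + y)) t x 2| ≤ |(fun t w => v t (w + y)) (-1) 0 2| := by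
    intro t ht x
    show Real.sqrt (-t) * |v t (x + y) 2| ≤ |v (-1) (0 + y) 2|
    rw [h0]; exact hhot t ht (x + y)
  have hpin := threadPin_of_hotSpot hrate' hcont' hmild' hhot' h
  -- `fderiv` of the translate at `0` is `fderiv` of `v(−1)` at `y`
  have hsm : IsSmoothSpaceTimeOn (Iio 0) v := (isTypeIAncientMild_of_class hrate hcont hmild hdiv).contDiffOn
  have hVd : Differentiable ℝ (v (-1)) :=
    (IsSmoothSpaceTimeOn.contDiff_slice (S := Iio 0) (w := v) hsm (by norm_num : (-1 : ℝ) < 0)).differentiable (by simp)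
  have hcomp : fderiv ℝ (fun w : EuclideanSpace ℝ (Fin 3) => v (-1) (w + y)) 0 = fderiv ℝ (v (-1)) y := by
    have h1 : HasFDerivAt (fun w : EuclideanSpace ℝ (Fin 3) => w + y) (ContinuousLinearMap.id ℝ _) 0 :=
      (hasFDerivAt_id (0 : EuclideanSpace ℝ (Fin 3))).add_const y
    have h2 : HasFDerivAt (v (-1)) (fderiv ℝ (v (-1)) y) ((fun w : EuclideanSpace ℝ (Fin 3) => w + y) 0) := by
      show HasFDerivAt (v (-1)) (fderiv ℝ (v (-1)) y) (0 + y)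
      rw [zero_add]; exact (hVd y).hasFDerivAt
    have h3 : HasFDerivAt (fun w : EuclideanSpace ℝ (Fin 3) => v (-1) (w + y))
        ((fderiv ℝ (v (-1)) y).comp (ContinuousLinearMap.id ℝ _)) 0 := h2.comp (0 : EuclideanSpace ℝ (Fin 3)) h1
    rw [h3.fderiv]; simp
  have hpin' : fderiv ℝ (fun w : EuclideanSpace ℝ (Fin 3) => v (-1) (w + y)) 0 h 2 = 0 := hpin
  rw [hcomp] at hpin'
  exact hpin'

/-- **Time pin at every hot point:** `∂ₜv₂(−1,y) = v₂(−1,0)/2` whenever `v₂(−1,y) = v₂(−1,0) ≠ 0`. -/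
theorem timePin_of_hotPoint (hrate : HasTypeITimeDecay C v)
    (hcont : ContinuousOn (uncurry v) (Iio (0 : ℝ) ×ˢ univ))
    (hmild : ∀ s t : ℝ, s < t → t < 0 → ∀ x, v t x = heatExtension (v s) (t - s) x - oseenDuhamel 1 s v v t x)
    (hdiv : ∀ t < 0, VectorCalculus.IsDivFree (v t))
    (hne : v (-1) 0 2 ≠ 0) (hhot : ∀ t < 0, ∀ x, Real.sqrt (-t) * |v t x 2| ≤ |v (-1) 0 2|)
    {y : EuclideanSpace ℝ (Fin 3)} (hy : v (-1) y 2 = v (-1) 0 2) :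
    deriv (fun s => v s y 2) (-1) = v (-1) 0 2 / 2 := by
  obtain ⟨hrate', hcont', hmild', -⟩ := class_comp_add_right hrate hcont hmild hdiv y
  obtain ⟨hne', hhot'⟩ := hotNormalisation_translate hne hhot hy
  have h := threadTimePin hrate' hcont' hmild' hne' hhot'
  simp only [zero_add] at h
  rw [h, hy]

/-- **Laplacian pin at every hot point:** `v₂(−1,0) · Δ(v₂(−1,·))(y) ≤ 0` whenever `v₂(−1,y) = v₂(−1,0) ≠ 0`. -/
theorem laplacianPin_of_hotPoint (hrate : HasTypeITimeDecay C v)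
    (hcont : ContinuousOn (uncurry v) (Iio (0 : ℝ) ×ˢ univ))
    (hmild : ∀ s t : ℝ, s < t → t < 0 → ∀ x, v t x = heatExtension (v s) (t - s) x - oseenDuhamel 1 s v v t x)
    (hdiv : ∀ t < 0, VectorCalculus.IsDivFree (v t))
    (hne : v (-1) 0 2 ≠ 0) (hhot : ∀ t < 0, ∀ x, Real.sqrt (-t) * |v t x 2| ≤ |v (-1) 0 2|)
    {y : EuclideanSpace ℝ (Fin 3)} (hy : v (-1) y 2 = v (-1) 0 2) :
    v (-1) 0 2 * (Δ (fun w => v (-1) w 2)) y ≤ 0 := by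
  obtain ⟨hrate', hcont', hmild', -⟩ := class_comp_add_right hrate hcont hmild hdiv y
  obtain ⟨hne', hhot'⟩ := hotNormalisation_translate hne hhot hy
  have h := threadSpacePin hrate' hcont' hmild' hne' hhot'
  -- `Δ` of the translate at `0` is `Δ` at `y`
  have htr : (Δ (fun w : EuclideanSpace ℝ (Fin 3) => v (-1) (w + y) 2)) 0 = (Δ (fun w => v (-1) w 2)) y := by
    rw [InnerProductSpace.laplacian_eq_iteratedFDeriv_stdOrthonormalBasis, InnerProductSpace.laplacian_eq_iteratedFDeriv_stdOrthonormalBasis]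
    refine Finset.sum_congr rfl fun i _ => ?_
    rw [iteratedFDeriv_comp_add_right (f := fun w : EuclideanSpace ℝ (Fin 3) => v (-1) w 2) 2 y 0]
    simp
  have e : (fun t w => v t (w + y)) (-1) 0 2 = v (-1) 0 2 := by
    show v (-1) (0 + y) 2 = v (-1) 0 2
    rw [zero_add]; exact hy
  have e2 : (fun w => (fun t w => v t (w + y)) (-1) w 2) = fun w : EuclideanSpace ℝ (Fin 3) => v (-1) (w + y) 2 := rfl
  rw [e, e2, htr] at h
  exact h

/-- **Vertical pressure identity at every hot point:** for every classical pressure `P` of the profile on `t < 0` and every `y` with `v₂(−1,y) = v₂(−1,0) ≠ 0`,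
`(∇P(−1,·))(y)₂ = Δ(v₂(−1,·))(y) − v₂(−1,0)/2` (vertical momentum equation at `(−1,y)`: `∂ₜv₂ = N/2`, `(v·∇)v₂ = 0` by the gradient pin). -/
theorem gradient_pressure_two_of_hotPoint (hrate : HasTypeITimeDecay C v)
    (hcont : ContinuousOn (uncurry v) (Iio (0 : ℝ) ×ˢ univ))
    (hmild : ∀ s t : ℝ, s < t → t < 0 → ∀ x, v t x = heatExtension (v s) (t - s) x - oseenDuhamel 1 s v v t x)
    (hdiv : ∀ t < 0, VectorCalculus.IsDivFree (v t))
    (hne : v (-1) 0 2 ≠ 0) (hhot : ∀ t < 0, ∀ x, Real.sqrt (-t) * |v t x 2| ≤ |v (-1) 0 2|)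
    {y : EuclideanSpace ℝ (Fin 3)} (hy : v (-1) y 2 = v (-1) 0 2)
    {P : ℝ → EuclideanSpace ℝ (Fin 3) → ℝ} (hP : IsClassicalNSSolutionOn (Iio 0) 1 0 v P) :
    gradient (P (-1)) y 2 = (Δ (fun w => v (-1) w 2)) y - v (-1) 0 2 / 2 := by
  have hs : (-1 : ℝ) < 0 := by norm_num
  have hsm : IsSmoothSpaceTimeOn (Iio 0) v := hP.smooth_velocity
  have hmom := hP.momentum (-1) hs y
  have htd : timeDerivWithin (Iio 0) v (-1) y = deriv (fun s => v s y) (-1) := by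
    rw [timeDerivWithin_apply, derivWithin_of_mem_nhds (Iio_mem_nhds hs)]
  rw [htd, convect_apply, one_smul, Pi.zero_apply, Pi.zero_apply, add_zero] at hmom
  have hct : ContDiffAt ℝ ∞ (uncurry v) ((-1 : ℝ), y) := hsm.contDiffAt isOpen_Iio (mem_Iio.2 hs) y
  have hd : DifferentiableAt ℝ (uncurry v) ((-1 : ℝ), y) := hct.differentiableAt (by simp)
  have hl : DifferentiableAt ℝ (fun s : ℝ => ((s, y) : ℝ × EuclideanSpace ℝ (Fin 3))) (-1) :=
    differentiableAt_id.prodMk (differentiableAt_const _)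
  have hline : DifferentiableAt ℝ (fun s => v s y) (-1) := by
    have h := hd.comp (-1) hl
    exact h
  have hslice : ContDiff ℝ ∞ (v (-1)) := IsSmoothSpaceTimeOn.contDiff_slice (S := Iio 0) (w := v) hsm hs
  have hslice2 : ContDiffAt ℝ 2 (v (-1)) y := (hslice.of_le (by norm_cast)).contDiffAt
  have hcomp := congrArg (fun w : EuclideanSpace ℝ (Fin 3) => w 2) hmom
  simp only [PiLp.add_apply, PiLp.sub_apply] at hcomp
  rw [deriv_apply_coord hline 2, timePin_of_hotPoint hrate hcont hmild hdiv hne hhot hy,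
    gradPin_of_hotPoint hrate hcont hmild hdiv hhot hy (v (-1) y), laplacian_apply_coord hslice2 2] at hcomp
  linarith

/-- **Pressure push at every hot point:** `v₂(−1,0) · (∇P(−1,·))(y)₂ ≤ −v₂(−1,0)²/2` — the vertical pressure gradient opposes `v₂` uniformly along the whole
hot set (ridge or hot plane). -/
theorem pressurePush_of_hotPoint (hrate : HasTypeITimeDecay C v)
    (hcont : ContinuousOn (uncurry v) (Iio (0 : ℝ) ×ˢ univ))
    (hmild : ∀ s t : ℝ, s < t → t < 0 → ∀ x, v t x = heatExtension (v s) (t - s) x - oseenDuhamel 1 s v v t x)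
    (hdiv : ∀ t < 0, VectorCalculus.IsDivFree (v t))
    (hne : v (-1) 0 2 ≠ 0) (hhot : ∀ t < 0, ∀ x, Real.sqrt (-t) * |v t x 2| ≤ |v (-1) 0 2|)
    {y : EuclideanSpace ℝ (Fin 3)} (hy : v (-1) y 2 = v (-1) 0 2)
    {P : ℝ → EuclideanSpace ℝ (Fin 3) → ℝ} (hP : IsClassicalNSSolutionOn (Iio 0) 1 0 v P) :
    v (-1) 0 2 * gradient (P (-1)) y 2 ≤ -(v (-1) 0 2) ^ 2 / 2 := by
  have heq := gradient_pressure_two_of_hotPoint hrate hcont hmild hdiv hne hhot hy hP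
  have hsp := laplacianPin_of_hotPoint hrate hcont hmild hdiv hne hhot hy
  rw [heq, mul_sub]
  nlinarith [hsp]

end Summit.NavierStokesRegularity.NavierStokesRegularity.Theorems.PoloidalWindowDoorLrcModEntireTwistingTHHotPointPins
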